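import Summits.QuantumFields.YangMills.Theorems.LangevinControlUVFemtoCurvatureSkewnessCRatioTransportDefsG
import Summits.QuantumFields.YangMills.Theorems.LangevinControlUVFemtoCurvatureSkewnessCQualitativeDescent
import Summits.QuantumFields.YangMills.Theorems.FemtoCurvatureSkewnessC.Negative.ClausesAndFreedom

/-!
# Crux `FemtoCurvatureSkewnessC` (stmt-QuantumFields-16205), line `ratio-transport`: DOMINANCE bridges and skeleton v5's composition

Lead `prover-line-stmt-QuantumFields-16205-c3-0` (line lead, cycle 4, 2026-08-16), companion proof file of the vocabulary (G)
`LangevinControlUVFemtoCurvatureSkewnessCRatioTransportDefsG.lean`.  Theorems only, no `sorry`, nothing posited; `rpow` algebra plus the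
LANDED `pressureCGF_holds`, `torusPropAxis_pos` / `torusPropDiag_pos`, `signedRigidity_of_dominance`, `signedRigidity_of_ratioFloor`
(p123064), `skewnessPackage_of_signedRigidity`, `ratioFloor_of_twoEndedQ` (p128513), `ratioFloor_of_dominated` (p125209),
`continuous_package_maps_comparable` (p122784) and `femtoCurvatureSkewnessC_iff` (`Iff.rfl`).

* `skewRatioT_ge_of_treeBounds` — POINTWISE: tree bounds on `κ₃`, `Cov` with a fixed relative error `θ < 1` and one coupling factor
  `λ` put the ratio `u` above `(1−θ)·8d/((1+θ)·2d)^{3/2}` (`λ`, `G_a`, `G_d` cancel exactly).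
* `ratioFloor_of_pressureDominance` — `PressureDominance r a → RatioFloor r a` on the SAME femto boxes (no transport, no anchors).
* `ratioFloorC_of_pressureDominanceC`, `ratioFloorC_of_markedCouplingDominance` — the fixed-relative-error engine statements give
  skeleton v5's single stub (floor moved to the hypothesis map's boxes by the landed ruler rigidity).
* `ratioFloorC_of_enginesQ`, `ratioFloorC_of_engineQ` — skeleton v4.2's four stubs give v5's single stub (the reshape is MONOTONE).
* `femtoCurvatureSkewnessC_of_ratioFloorC` — skeleton v5's composition: `RatioFloorC` ALONE closes the served crux BY NAME (output map =
  the hypothesis map).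
* `femtoCurvatureSkewnessC_of_pressureDominanceC`, `femtoCurvatureSkewnessC_of_markedCouplingDominance` — ONE fixed-relative-error
  physics statement closes the crux (the sibling line `coupling-cubic-response`'s engine stub E alone; observed by the crux's refuter,
  `Attack.lean` 18:21Z, here landed).

Upshot for the planners (cycle-4 verdict of the lead): the crux item now carries ONE registered target, `stub_ratioFloorC : RatioFloorC`;
promote ONE physics item — `PressureDominanceC` (engine form) or `RatioFloorC` (corollary form) — not v4.2's (P) continuum-limit engine
+ (A) fixed-torus anchors, which cost strictly more.
-/

set_option autoImplicit false

noncomputable section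

namespace Summit.QuantumFields.YangMills.Cruxes.FemtoCurvatureSkewnessC.RatioTransport

open MeasureTheory Filter Topology
open Literature.MathematicalPhysics.QuantumFieldTheory
open Summit.QuantumFields.YangMills.Theorems.FemtoCurvatureSkewness.Negative (kappa3 TwoPointPackage SkewnessPackage)
open Summit.QuantumFields.YangMills.Cruxes.FemtoCurvatureSkewness.CouplingCubicResponse
  (covAxis torusPropAxis torusPropDiag torusPropAxis_pos torusPropDiag_pos IsHonestUnitMap PressureDominance
    MarkedCouplingDominance pressureCGF_holds D3 D2 SignedRigidity signedRigidity_of_dominance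
    skewnessPackage_of_signedRigidity)
open Summit.QuantumFields.YangMills.Theses.LangevinControlUV (FemtoCurvatureSkewnessC)
open Summit.QuantumFields.YangMills.Theorems.FemtoCurvatureSkewness (femtoCurvatureSkewnessC_iff)
open Summit.QuantumFields.YangMills.Theorems.FemtoCurvatureSkewnessC.Negative (continuous_package_maps_comparable)

section Pointwise

variable {G : Type} [Group G] [TopologicalSpace G] [IsTopologicalGroup G] [CompactSpace G]
  [MeasurableSpace G] [BorelSpace G]

/-- **Pointwise: tree bounds with a fixed relative error `θ < 1` put the ratio above `u₀(θ, d) = (1−θ)·8d/((1+θ)·2d)^{3/2}`** — the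
coupling factor `λ` and the propagators `G_a`, `G_d` cancel exactly.  (The one computation behind both the fixed-torus anchors and the
femto-box floor.) -/
theorem skewRatioT_ge_of_treeBounds (r : LatticeRep G) (L : ℕ) [NeZero L] (β : ℝ) (n : ℕ) (hn : 1 ≤ n) (h8 : 8 * n ≤ L)
    {θ d lam : ℝ} (hθ0 : 0 ≤ θ) (hθ1 : θ < 1) (hd : 0 < d) (hlam : 0 < lam)
    (h3 : |kappa3 r L β n - 8 * d * lam ^ 3 * (torusPropAxis L n ^ 2 * torusPropDiag L n)| ≤
      θ * (8 * d * lam ^ 3 * (torusPropAxis L n ^ 2 * torusPropDiag L n)))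
    (h2 : |covAxis r L β n - 2 * d * lam ^ 2 * torusPropAxis L n ^ 2| ≤ θ * (2 * d * lam ^ 2 * torusPropAxis L n ^ 2)) :
    (1 - θ) * 8 * d / ((1 + θ) * 2 * d) ^ (3 / 2 : ℝ) ≤ skewRatioT r L β n := by
  have h1θ : 0 < 1 - θ := by linarith
  have h1θ' : 0 < 1 + θ := by linarith
  set κ : ℝ := (1 + θ) * 2 * d with hκ
  have hκpos : 0 < κ := by rw [hκ]; exact mul_pos (mul_pos h1θ' two_pos) hd
  have hκ32 : 0 < κ ^ (3 / 2 : ℝ) := Real.rpow_pos_of_pos hκpos _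
  have hnum : 0 < (1 - θ) * 8 * d := mul_pos (mul_pos h1θ (by norm_num)) hd
  have hA : 0 < torusPropAxis L n := torusPropAxis_pos L n hn h8
  have hDg : 0 < torusPropDiag L n := torusPropDiag_pos L n hn h8
  unfold skewRatioT
  set Cv := covAxis r L β n with hCv
  set K := kappa3 r L β n with hK
  set Ga := torusPropAxis L n with hGa
  set Gd := torusPropDiag L n with hGd
  have hKlow : (1 - θ) * (8 * d * lam ^ 3 * (Ga ^ 2 * Gd)) ≤ K := by
    have := (abs_sub_le_iff.1 h3).2
    linarith
  have hCup : Cv ≤ (1 + θ) * (2 * d * lam ^ 2 * Ga ^ 2) := by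
    have := (abs_sub_le_iff.1 h2).1
    linarith
  have hClow : (1 - θ) * (2 * d * lam ^ 2 * Ga ^ 2) ≤ Cv := by
    have := (abs_sub_le_iff.1 h2).2
    linarith
  have hCpos : 0 < Cv :=
    lt_of_lt_of_le (mul_pos h1θ (mul_pos (mul_pos (mul_pos two_pos hd) (pow_pos hlam 2)) (pow_pos hA 2))) hClow
  have hA0 : 0 < lam * Ga := mul_pos hlam hA
  have hCup' : Cv ≤ κ * (lam * Ga) ^ 2 := by
    have : (1 + θ) * (2 * d * lam ^ 2 * Ga ^ 2) = κ * (lam * Ga) ^ 2 := by simp only [hκ]; ring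
    linarith
  have hsq3 : ((lam * Ga) ^ 2) ^ (3 / 2 : ℝ) = (lam * Ga) ^ 3 := by
    rw [show ((lam * Ga) ^ 2 : ℝ) = (lam * Ga) ^ (2 : ℝ) by norm_cast, ← Real.rpow_mul hA0.le]
    norm_num
  have hC32 : Cv ^ (3 / 2 : ℝ) ≤ κ ^ (3 / 2 : ℝ) * (lam * Ga) ^ 3 := by
    calc Cv ^ (3 / 2 : ℝ) ≤ (κ * (lam * Ga) ^ 2) ^ (3 / 2 : ℝ) :=
          Real.rpow_le_rpow hCpos.le hCup' (by norm_num)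
      _ = κ ^ (3 / 2 : ℝ) * (lam * Ga) ^ 3 := by
          rw [Real.mul_rpow hκpos.le (sq_nonneg _), hsq3]
  have hC32pos : 0 < Cv ^ (3 / 2 : ℝ) := Real.rpow_pos_of_pos hCpos _
  have hden : 0 < Cv ^ (3 / 2 : ℝ) * Gd := mul_pos hC32pos hDg
  rw [le_div_iff₀ hden]
  have hu₀ : 0 ≤ (1 - θ) * 8 * d / κ ^ (3 / 2 : ℝ) := (div_pos hnum hκ32).le
  calc (1 - θ) * 8 * d / κ ^ (3 / 2 : ℝ) * (Cv ^ (3 / 2 : ℝ) * Gd)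
      ≤ (1 - θ) * 8 * d / κ ^ (3 / 2 : ℝ) * (κ ^ (3 / 2 : ℝ) * (lam * Ga) ^ 3 * Gd) := by
        apply mul_le_mul_of_nonneg_left _ hu₀
        exact mul_le_mul_of_nonneg_right hC32 hDg.le
    _ = (1 - θ) * (8 * d * lam ^ 3 * (Ga ^ 2 * Gd)) * Ga := by
        field_simp
    _ ≤ K * Ga := mul_le_mul_of_nonneg_right hKlow hA.le

/-- **Pressure dominance on the femto boxes of `a` ⇒ a ratio floor on the SAME boxes** (no transport, no anchors, no limit): the
landed `PressureCGF` identities turn `−D₃`, `D₂` into `κ₃`, `Cov`; the pointwise lemma does the rest, with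
`u₁ = (1−θ)·8d/((1+θ)·2d)^{3/2}`. -/
theorem ratioFloor_of_pressureDominance (r : LatticeRep G) {a : ℝ → ℝ} (hD : PressureDominance r a) : RatioFloor r a := by
  obtain ⟨β₁, ℓ₁, θ, d, hℓ₁, hθ0, hθ1, hd, H⟩ := hD
  have h1θ : 0 < 1 - θ := by linarith
  have h1θ' : 0 < 1 + θ := by linarith
  have hκpos : 0 < (1 + θ) * 2 * d := mul_pos (mul_pos h1θ' two_pos) hd
  refine ⟨β₁, ℓ₁, (1 - θ) * 8 * d / ((1 + θ) * 2 * d) ^ (3 / 2 : ℝ), hℓ₁,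
    div_pos (mul_pos (mul_pos h1θ (by norm_num)) hd) (Real.rpow_pos_of_pos hκpos _), ?_⟩
  intro L _ β n hβ hL hn h8
  obtain ⟨lam, hlam, h3, h2⟩ := H L β hβ hL n hn h8
  obtain ⟨hI3, hI2⟩ := pressureCGF_holds G r L β n
  have e3 : -D3 r L β n = kappa3 r L β n := by
    show -(D3 r L β n) = kappa3 r L β n
    rw [show D3 r L β n = -kappa3 r L β n from hI3, neg_neg]
  have e2 : D2 r L β n = covAxis r L β n := hI2
  rw [e3] at h3
  rw [e2] at h2
  exact skewRatioT_ge_of_treeBounds r L β n hn h8 hθ0 hθ1 hd hlam h3 h2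

/-- **Signed rigidity in C-form from a ratio floor at a continuous package map** (the line's landed back half, p123064). -/
theorem signedRigidity_of_ratioFloorC (hF : RatioFloorC) {G : Type} [Group G] [TopologicalSpace G] [IsTopologicalGroup G]
    [CompactSpace G] [MeasurableSpace G] [BorelSpace G] (hG : IsCompactSimpleLieGroup G) (r : LatticeRep G) {a₀ : ℝ → ℝ}
    (ha₀ : Continuous a₀) (hP₀ : TwoPointPackage r a₀) : SignedRigidity r a₀ :=
  signedRigidity_of_ratioFloor r hP₀ (hF G hG r a₀ ha₀ hP₀)

end Pointwise

/-- **`PressureDominanceC ⇒ RatioFloorC`**: the engine's continuous package map `a` carries a ratio floor on its own femto boxes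
(`ratioFloor_of_pressureDominance`); by the landed ruler rigidity (`continuous_package_maps_comparable`) `a ≤ K·a₀` eventually for
the hypothesis map `a₀`, so the floor holds on `a₀`'s femto boxes below `ℓ₁/K`. -/
theorem ratioFloorC_of_pressureDominanceC (hE : PressureDominanceC) : RatioFloorC := by
  intro G _ _ _ _ _ _ hG r a₀ ha₀ hP₀
  obtain ⟨a, ha, hP, hD⟩ := hE G hG r ⟨a₀, ha₀, hP₀⟩
  obtain ⟨K, β₃, hK, hKβ⟩ := continuous_package_maps_comparable r hP₀ hP ha₀ ha
  exact ratioFloor_of_dominated r (ratioFloor_of_pressureDominance r hD) ⟨K, β₃, hK, fun β hβ => (hKβ β hβ).1⟩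

/-- `MarkedCouplingDominance` (the sibling line's engine stub E: weaker hypothesis, honest output) implies the C-form. -/
theorem pressureDominanceC_of_markedCouplingDominance (hE : MarkedCouplingDominance) : PressureDominanceC := by
  intro G _ _ _ _ _ _ hG r hex
  obtain ⟨a₀, -, hP₀⟩ := hex
  obtain ⟨a, hhon, hP, hD⟩ := hE G hG r ⟨a₀, hP₀⟩
  exact ⟨a, hhon.2.2.1, hP, hD⟩

/-- **`MarkedCouplingDominance ⇒ RatioFloorC`.** -/
theorem ratioFloorC_of_markedCouplingDominance (hE : MarkedCouplingDominance) : RatioFloorC :=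
  ratioFloorC_of_pressureDominanceC (pressureDominanceC_of_markedCouplingDominance hE)

/-- **Skeleton v4.2 ⇒ skeleton v5 (the reshape is monotone)**: the four v4.2 stubs E_c (two-ended), E_v, E_s (qualitative) and A give
the single v5 stub, by the landed rate-free descent `ratioFloor_of_twoEndedQ` (p128513). -/
theorem ratioFloorC_of_enginesQ (hc : CutoffEngineTE) (hv : VolumeEngineQ) (hs : SeparationEngineQ) (hA : Anchors) :
    RatioFloorC := by
  intro G _ _ _ _ _ _ hG r a₀ ha₀ hP₀
  obtain ⟨M, hM, a, ha, hpos, hdom, hcut⟩ := hc G hG r a₀ ha₀ hP₀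
  obtain ⟨Γ, β₀, ℓ₀, c, C, -, -, hpos₀, -, -⟩ := id hP₀
  obtain ⟨hvm, hvc⟩ := hv G hG r a₀ ha₀ hP₀
  exact ratioFloor_of_twoEndedQ r a a₀ hM hpos ha hpos₀ hdom (hA G hG r ⟨a₀, ha₀, hP₀⟩) hcut hvm hvc (hs G hG r a₀ ha₀ hP₀)

/-- The merged v4.2 engine statement and the anchors give the v5 stub. -/
theorem ratioFloorC_of_engineQ (hE : RatioTransportEngineQ) (hA : Anchors) : RatioFloorC := by
  obtain ⟨hc, hv, hs⟩ := engineQ_iff.1 hE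
  exact ratioFloorC_of_enginesQ hc hv hs hA

/-- **Skeleton v5's composition: `RatioFloorC` ALONE closes the served crux BY NAME** — output map = the hypothesis map `a₀`
(continuous by hypothesis, package by hypothesis); floor ⇒ signed rigidity by `a₀`'s own package (`signedRigidity_of_ratioFloor`,
p123064) ⇒ skewness package (`skewnessPackage_of_signedRigidity`) ⇒ the crux (`femtoCurvatureSkewnessC_iff`, `Iff.rfl`). -/
theorem femtoCurvatureSkewnessC_of_ratioFloorC (hF : RatioFloorC) : FemtoCurvatureSkewnessC := by
  rw [femtoCurvatureSkewnessC_iff]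
  intro G _ _ _ _ hG
  letI : MeasurableSpace G := borel G
  haveI : BorelSpace G := ⟨rfl⟩
  intro r hex
  obtain ⟨a₀, ha₀, hP₀⟩ := hex
  exact ⟨a₀, ha₀, hP₀, skewnessPackage_of_signedRigidity r hP₀
    (signedRigidity_of_ratioFloor r hP₀ (hF G hG r a₀ ha₀ hP₀))⟩

/-- **ONE fixed-relative-error physics statement closes the crux**: `PressureDominanceC → FemtoCurvatureSkewnessC`.  Direct proof
(output map = the engine's own continuous package map; no ruler rigidity needed): pressure dominance ⇒ signed rigidity
(`signedRigidity_of_dominance`, landed with the sibling line) ⇒ skewness package. -/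
theorem femtoCurvatureSkewnessC_of_pressureDominanceC (hE : PressureDominanceC) : FemtoCurvatureSkewnessC := by
  rw [femtoCurvatureSkewnessC_iff]
  intro G _ _ _ _ hG
  letI : MeasurableSpace G := borel G
  haveI : BorelSpace G := ⟨rfl⟩
  intro r hex
  obtain ⟨a, ha, hP, hD⟩ := hE G hG r hex
  exact ⟨a, ha, hP, skewnessPackage_of_signedRigidity r hP (signedRigidity_of_dominance r a hD)⟩

/-- **The sibling line's engine stub E ALONE closes this crux** (`MarkedCouplingDominance → FemtoCurvatureSkewnessC`; observed by the
crux's refuter in `Attack.lean`, 18:21Z, here landed): its output map is honest, hence continuous. -/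
theorem femtoCurvatureSkewnessC_of_markedCouplingDominance (hE : MarkedCouplingDominance) : FemtoCurvatureSkewnessC :=
  femtoCurvatureSkewnessC_of_pressureDominanceC (pressureDominanceC_of_markedCouplingDominance hE)

end Summit.QuantumFields.YangMills.Cruxes.FemtoCurvatureSkewnessC.RatioTransport

end
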